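import Summits.Ventures.LatticeQCDFlow.Scaling.HubClassChainTransitionLaw
import Summits.Ventures.LatticeQCDFlow.Scaling.HubChainResolvent

/-!
HONEST FRAMING: exact (Metropolis-corrected) sampling algorithms for lattice gauge theory; figures
of merit are autocorrelation/cost numbers at stated couplings and volumes; no continuum-physics
claim.

# HubClassChainResolvent — THE SWAP PHASE SOLVED EXACTLY, XI: THE σ-RESOLVENT OF THE CONTENT-CLASS HUB CHAIN — CHAPTER W'S END-HUB LAW `u = (1−σ)δ + σuKh` ITSELF — IN CLOSED FORM
# `u(i,j) = N_jρ_j·(1/R + Σ_k γ_kf_k(i)f_k(j)N_k/(ρ_kR_kR_{k+1}))`, `γ_k = (1−σ)/(1−σβ_k)`, UNIQUE, WITH SMITH–TIERNEY FORM `u(i,j) = N_jρ_j·𝒯(max(i,j)) + γ_iδ_{ij}` (lean-2 GEN-39, ours)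

Venture-side (OURS).  Cell `lqcd-flow` (pub-lqcd), unit `pub-lqcd-lean-2-g39`, 2026-08-30.  Chapter Y, file 11 = file 3 with class weights (setting of files 7–8: `P(i,j) = cN_j·min{1,ρ_j/ρ_i}`,
`R_k = Σ_{i<k}N_iρ_i`, `M_k = Σ_{i≥k}N_i`, `f_k = ρ_k𝟙_{<k} − (R_k/N_k)𝟙_k`, `β_k = 1 − c(M_k + R_k/ρ_k)`).  Chapter W pins the end-hub law of a refresh cycle by
`u(x,v) = (1−σ)δ_{v = hub x} + σΣ_h u(x,h)Kh(comp x; h, v)`; on the depth-ranked contents present this is the row equation below, and: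

* `hubClass_resolvent_solves` (the closed form solves it), `hubClass_resolvent_unique` (maximum principle for `(v−w)/(Nρ)` via reversibility), **`hubClass_resolvent_eq`**;
* **`hubClass_resolvent_offdiag`** ∕ **`hubClass_resolvent_diag`**: `u(i,j) = N_jρ_j𝒯(max(i,j))` (`i ≠ j`), `u(j,j) = N_jρ_j𝒯(j) + γ_j`, `𝒯(j) = (1−γ_j)/R_m + Σ_{j<k<m}(1/R_k − 1/R_{k+1})(γ_k − γ_j)` — the
  same `𝒯` as file 3 with the class-weighted `R`, `β`.

Reading (no numerics implied): the gain `x̃(★)` and every tail-law value of MEMO-gen37's criterion are explicit rational functions of the depths and class sizes.  Literature grade (cell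
rule): OWN, elementary; nothing cited; no new bib keys.
-/

open Finset

namespace Summit.Ventures.LatticeQCDFlow.Scaling

section HubClassRes
variable {m : ℕ} {ρ N R M β γ : ℕ → ℝ} {c σ : ℝ} {P f u : ℕ → ℕ → ℝ} {Tr : ℕ → ℝ}

/-- `0 < 1 − σβ_k`, `0 < γ_k ≤ 1` (class weights; `c ≥ 0`, `σ ∈ [0,1)`). [ours] -/
theorem hubClass_gamma_pos (hρ : ∀ i, 0 < ρ i) (hN : ∀ i, 0 < N i) (hR : ∀ k, R k = ∑ i ∈ range k, N i * ρ i) (hM : ∀ k, M k = ∑ i ∈ Ico k m, N i)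
    (hβ : ∀ k, β k = 1 - c * (M k + R k / ρ k)) (hc : 0 ≤ c) (hσ0 : 0 ≤ σ) (hσ1 : σ < 1)
    (hγ : ∀ k, γ k = (1 - σ) / (1 - σ * β k)) {k : ℕ} (hk : k < m) : 0 < 1 - σ * β k ∧ 0 < γ k ∧ γ k ≤ 1 := by
  have hb := hubClass_beta_le hρ hN hR hM hβ hc hk
  have hNk := hN k
  have hb1 : β k ≤ 1 := by nlinarith
  have h1 : 0 < 1 - σ * β k := by nlinarith
  refine ⟨h1, by rw [hγ]; exact div_pos (by linarith) h1, ?_⟩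
  rw [hγ, div_le_one h1]; nlinarith

/-- **The closed form solves the resolvent equation** `u(i,j) = (1−σ)δ_{ij} + σΣ_{l<m}u(i,l)P(l,j)` (class weights). [ours] -/
theorem hubClass_resolvent_solves (hρ : ∀ i, 0 < ρ i) (hmono : Monotone ρ) (hN : ∀ i, 0 < N i) (hR : ∀ k, R k = ∑ i ∈ range k, N i * ρ i)
    (hM : ∀ k, M k = ∑ i ∈ Ico k m, N i)
    (hPoff : ∀ i j, i ≠ j → P i j = c * N j * min 1 (ρ j / ρ i)) (hPdiag : ∀ i, P i i = 1 - ∑ j ∈ (range m).erase i, P i j)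
    (hf : ∀ k i, f k i = if i < k then ρ k else if i = k then -(R k / N k) else 0)
    (hβ : ∀ k, β k = 1 - c * (M k + R k / ρ k)) (hc : 0 ≤ c) (hσ0 : 0 ≤ σ) (hσ1 : σ < 1)
    (hγ : ∀ k, γ k = (1 - σ) / (1 - σ * β k)) {i j : ℕ} (hi : i < m) (hj : j < m) :
    N j * ρ j * (1 / R m + ∑ k ∈ range m, γ k * (f k i * f k j * N k) / (ρ k * R k * R (k + 1)))
      = (1 - σ) * (if i = j then 1 else 0) + σ * ∑ l ∈ range m, N l * ρ l * (1 / R m + ∑ k ∈ range m, γ k * (f k i * f k l * N k) / (ρ k * R k * R (k + 1))) * P l j := by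
  have hpush : ∑ l ∈ range m, N l * ρ l * (1 / R m + ∑ k ∈ range m, γ k * (f k i * f k l * N k) / (ρ k * R k * R (k + 1))) * P l j
      = N j * ρ j * (1 / R m + ∑ k ∈ range m, γ k * β k * (f k i * f k j * N k) / (ρ k * R k * R (k + 1))) := by
    calc ∑ l ∈ range m, N l * ρ l * (1 / R m + ∑ k ∈ range m, γ k * (f k i * f k l * N k) / (ρ k * R k * R (k + 1))) * P l j
        = ∑ l ∈ range m, ((1 / R m) * (N l * ρ l * P l j) + ∑ k ∈ range m, (γ k * f k i * N k / (ρ k * R k * R (k + 1))) * (N l * ρ l * f k l * P l j)) := by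
          refine sum_congr rfl fun l _ => ?_
          rw [mul_add, add_mul, mul_sum, sum_mul]
          congr 1
          · ring
          · exact sum_congr rfl fun k _ => by ring
      _ = (1 / R m) * (N j * ρ j) + ∑ k ∈ range m, (γ k * f k i * N k / (ρ k * R k * R (k + 1))) * (β k * (N j * ρ j) * f k j) := by
          rw [sum_add_distrib, ← mul_sum, hubClass_rho_stationary hρ hPoff hPdiag hj, sum_comm]
          congr 1
          exact sum_congr rfl fun k hk => by rw [← mul_sum, hubClass_eigen_left hρ hmono hN hR hM hPoff hPdiag hf hβ (mem_range.mp hk) hj]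
      _ = N j * ρ j * (1 / R m + ∑ k ∈ range m, γ k * β k * (f k i * f k j * N k) / (ρ k * R k * R (k + 1))) := by
          rw [mul_add, mul_sum]; congr 1; · ring
          · exact sum_congr rfl fun k _ => by ring
  rw [hpush, ← hubClass_complete hρ hN hR hf hi hj]
  have e : ∑ k ∈ range m, γ k * (f k i * f k j * N k) / (ρ k * R k * R (k + 1))
      = (1 - σ) * ∑ k ∈ range m, f k i * f k j * N k / (ρ k * R k * R (k + 1)) + σ * ∑ k ∈ range m, γ k * β k * (f k i * f k j * N k) / (ρ k * R k * R (k + 1)) := by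
    rw [mul_sum, mul_sum, ← sum_add_distrib]
    refine sum_congr rfl fun k hk => ?_
    have h1 := (hubClass_gamma_pos hρ hN hR hM hβ hc hσ0 hσ1 hγ (mem_range.mp hk)).1
    have hγk : γ k = (1 - σ) + σ * (γ k * β k) := by rw [hγ]; field_simp; ring
    calc γ k * (f k i * f k j * N k) / (ρ k * R k * R (k + 1)) = ((1 - σ) + σ * (γ k * β k)) * (f k i * f k j * N k) / (ρ k * R k * R (k + 1)) := by rw [← hγk]
      _ = (1 - σ) * (f k i * f k j * N k / (ρ k * R k * R (k + 1))) + σ * (γ k * β k * (f k i * f k j * N k) / (ρ k * R k * R (k + 1))) := by ring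
  rw [e]; ring

/-- **Uniqueness for the resolvent equation on `range m` (class weights):** `c(M_0 − N_k) ≤ 1` for all `k` (so `P ≥ 0`), `σ ∈ [0,1)`. [ours] -/
theorem hubClass_resolvent_unique (hρ : ∀ i, 0 < ρ i) (hmono : Monotone ρ) (hN : ∀ i, 0 < N i) (hR : ∀ k, R k = ∑ i ∈ range k, N i * ρ i)
    (hM : ∀ k, M k = ∑ i ∈ Ico k m, N i)
    (hPoff : ∀ i j, i ≠ j → P i j = c * N j * min 1 (ρ j / ρ i)) (hPdiag : ∀ i, P i i = 1 - ∑ j ∈ (range m).erase i, P i j)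
    (hβ : ∀ k, β k = 1 - c * (M k + R k / ρ k)) (hc : 0 ≤ c) (hcm : ∀ k, k < m → c * (M 0 - N k) ≤ 1) (hσ0 : 0 ≤ σ) (hσ1 : σ < 1)
    {g v w : ℕ → ℝ} (hv : ∀ j, j < m → v j = g j + σ * ∑ l ∈ range m, v l * P l j) (hw : ∀ j, j < m → w j = g j + σ * ∑ l ∈ range m, w l * P l j) :
    ∀ j, j < m → v j = w j := by
  classical
  have hP0 : ∀ i j, i < m → j < m → 0 ≤ P i j := by
    intro i j hi hj
    by_cases hij : i = j
    · subst hij; exact hubClass_diag_nonneg hρ hmono hN hR hM hPoff hPdiag hβ hc hi (hcm i hi)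
    · rw [hPoff i j hij]; exact mul_nonneg (mul_nonneg hc (hN j).le) (le_min zero_le_one (div_nonneg (hρ j).le (hρ i).le))
  set h : ℕ → ℝ := fun j => (v j - w j) / (N j * ρ j) with hh
  have hrow : ∀ j, j < m → h j = σ * ∑ l ∈ range m, P j l * h l := by
    intro j hj
    have e2 : σ * ∑ l ∈ range m, (v l - w l) * P l j = σ * ∑ l ∈ range m, v l * P l j - σ * ∑ l ∈ range m, w l * P l j := by
      rw [← mul_sub, ← sum_sub_distrib]; congr 1; exact sum_congr rfl fun l _ => by ring
    have e : v j - w j = σ * ∑ l ∈ range m, (v l - w l) * P l j := by rw [e2, hv j hj, hw j hj]; ring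
    simp only [hh]
    rw [e, mul_div_assoc, sum_div]
    congr 1
    refine sum_congr rfl fun l _ => ?_
    have hrev := hubClass_reversible hρ hPoff l j
    have hρj := (hρ j).ne'; have hρl := (hρ l).ne'; have hNj := (hN j).ne'; have hNl := (hN l).ne'
    field_simp
    linear_combination (v l - w l) * hrev
  by_cases hm : m = 0
  · intro j hj; omega
  obtain ⟨j₀, hj₀, hmax⟩ := exists_max_image (range m) (fun j => |h j|) ⟨0, mem_range.mpr (Nat.pos_of_ne_zero hm)⟩
  have hM' : |h j₀| ≤ σ * |h j₀| := by
    calc |h j₀| = |σ * ∑ l ∈ range m, P j₀ l * h l| := by rw [← hrow j₀ (mem_range.mp hj₀)]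
      _ ≤ σ * ∑ l ∈ range m, P j₀ l * |h l| := by
          rw [abs_mul, abs_of_nonneg hσ0]
          refine mul_le_mul_of_nonneg_left ((abs_sum_le_sum_abs _ _).trans (le_of_eq (sum_congr rfl fun l hl => ?_))) hσ0
          rw [abs_mul, abs_of_nonneg (hP0 j₀ l (mem_range.mp hj₀) (mem_range.mp hl))]
      _ ≤ σ * ∑ l ∈ range m, P j₀ l * |h j₀| :=
          mul_le_mul_of_nonneg_left (sum_le_sum fun l hl => mul_le_mul_of_nonneg_left (hmax l hl) (hP0 j₀ l (mem_range.mp hj₀) (mem_range.mp hl))) hσ0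
      _ = σ * |h j₀| := by rw [← sum_mul, hubChain_rowsum hPdiag (mem_range.mp hj₀), one_mul]
  have h0 : |h j₀| = 0 := by nlinarith [abs_nonneg (h j₀)]
  intro j hj
  have hj' : |h j| ≤ 0 := h0 ▸ hmax j (mem_range.mpr hj)
  have : h j = 0 := abs_eq_zero.mp (le_antisymm hj' (abs_nonneg _))
  simp only [hh] at this
  rcases div_eq_zero_iff.mp this with h1 | h1
  · linarith
  · exact absurd h1 (mul_pos (hN j) (hρ j)).ne'

/-- **CHAPTER W'S END-HUB LAW IN CLOSED FORM:** a solution of `u(i,j) = (1−σ)δ_{ij} + σΣ_{l<m}u(i,l)P(l,j)` (`j < m`) is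
`u(i,j) = N_jρ_j·(1/R_m + Σ_{k<m} γ_kf_k(i)f_k(j)N_k/(ρ_kR_kR_{k+1}))` for `i, j < m`. [ours] -/
theorem hubClass_resolvent_eq (hρ : ∀ i, 0 < ρ i) (hmono : Monotone ρ) (hN : ∀ i, 0 < N i) (hR : ∀ k, R k = ∑ i ∈ range k, N i * ρ i)
    (hM : ∀ k, M k = ∑ i ∈ Ico k m, N i)
    (hPoff : ∀ i j, i ≠ j → P i j = c * N j * min 1 (ρ j / ρ i)) (hPdiag : ∀ i, P i i = 1 - ∑ j ∈ (range m).erase i, P i j)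
    (hf : ∀ k i, f k i = if i < k then ρ k else if i = k then -(R k / N k) else 0)
    (hβ : ∀ k, β k = 1 - c * (M k + R k / ρ k)) (hc : 0 ≤ c) (hcm : ∀ k, k < m → c * (M 0 - N k) ≤ 1) (hσ0 : 0 ≤ σ) (hσ1 : σ < 1)
    (hγ : ∀ k, γ k = (1 - σ) / (1 - σ * β k))
    (hu : ∀ i j, j < m → u i j = (1 - σ) * (if i = j then 1 else 0) + σ * ∑ l ∈ range m, u i l * P l j) {i j : ℕ} (hi : i < m) (hj : j < m) :
    u i j = N j * ρ j * (1 / R m + ∑ k ∈ range m, γ k * (f k i * f k j * N k) / (ρ k * R k * R (k + 1))) :=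
  hubClass_resolvent_unique hρ hmono hN hR hM hPoff hPdiag hβ hc hcm hσ0 hσ1 (g := fun j => (1 - σ) * (if i = j then (1:ℝ) else 0))
    (v := fun j => u i j) (w := fun j => N j * ρ j * (1 / R m + ∑ k ∈ range m, γ k * (f k i * f k j * N k) / (ρ k * R k * R (k + 1))))
    (fun j hj => hu i j hj) (fun _ hj => hubClass_resolvent_solves hρ hmono hN hR hM hPoff hPdiag hf hβ hc hσ0 hσ1 hγ hi hj) j hj

/-- **Smith–Tierney form of the class resolvent, off the diagonal:** `u(i,j) = N_jρ_j·𝒯(max(i,j))`. [ours] -/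
theorem hubClass_resolvent_offdiag (hρ : ∀ i, 0 < ρ i) (hmono : Monotone ρ) (hN : ∀ i, 0 < N i) (hR : ∀ k, R k = ∑ i ∈ range k, N i * ρ i)
    (hM : ∀ k, M k = ∑ i ∈ Ico k m, N i)
    (hPoff : ∀ i j, i ≠ j → P i j = c * N j * min 1 (ρ j / ρ i)) (hPdiag : ∀ i, P i i = 1 - ∑ j ∈ (range m).erase i, P i j)
    (hf : ∀ k i, f k i = if i < k then ρ k else if i = k then -(R k / N k) else 0)
    (hβ : ∀ k, β k = 1 - c * (M k + R k / ρ k)) (hc : 0 ≤ c) (hcm : ∀ k, k < m → c * (M 0 - N k) ≤ 1) (hσ0 : 0 ≤ σ) (hσ1 : σ < 1)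
    (hγ : ∀ k, γ k = (1 - σ) / (1 - σ * β k))
    (hu : ∀ i j, j < m → u i j = (1 - σ) * (if i = j then 1 else 0) + σ * ∑ l ∈ range m, u i l * P l j)
    (hTr : ∀ j, Tr j = (1 - γ j) / R m + ∑ k ∈ Ico (j + 1) m, (1 / R k - 1 / R (k + 1)) * (γ k - γ j))
    {i j : ℕ} (hi : i < m) (hj : j < m) (hij : i ≠ j) : u i j = N j * ρ j * Tr (max i j) := by
  have hTexp : ∀ jj, jj < m → Tr jj = 1 / R m - γ jj / R (jj + 1) + ∑ k ∈ Ico (jj + 1) m, γ k * (1 / R k - 1 / R (k + 1)) := by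
    intro jj hjj
    rw [hTr]
    have e : ∑ k ∈ Ico (jj + 1) m, (1 / R k - 1 / R (k + 1)) * (γ k - γ jj)
        = ∑ k ∈ Ico (jj + 1) m, γ k * (1 / R k - 1 / R (k + 1)) - γ jj * ∑ k ∈ Ico (jj + 1) m, (1 / R k - 1 / R (k + 1)) := by
      rw [mul_sum, ← sum_sub_distrib]; exact sum_congr rfl fun k _ => by ring
    rw [e, hubChain_telescope hjj]
    ring
  rw [hubClass_resolvent_eq hρ hmono hN hR hM hPoff hPdiag hf hβ hc hcm hσ0 hσ1 hγ hu hi hj]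
  rcases Nat.lt_or_gt_of_ne hij with hlt | hgt
  · rw [max_eq_right hlt.le, hubClass_mode_sum hρ hN hR hf γ hlt.le hj, hTexp j hj]
    have hRj1 : R (j + 1) = R j + N j * ρ j := by rw [hR (j + 1), sum_range_succ, ← hR j]
    have hRj : 0 < R j := by rw [hR j]; exact sum_pos (fun i _ => mul_pos (hN i) (hρ i)) ⟨i, mem_range.mpr hlt⟩
    rw [hf j i, if_pos hlt, hf j j, if_neg (lt_irrefl j), if_pos rfl, hRj1]
    have hρj := hρ j; have hNj := hN j
    field_simp
    ring
  · rw [max_eq_left hgt.le]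
    rw [show (∑ k ∈ range m, γ k * (f k i * f k j * N k) / (ρ k * R k * R (k + 1))) = ∑ k ∈ range m, γ k * (f k j * f k i * N k) / (ρ k * R k * R (k + 1)) from
      sum_congr rfl fun k _ => by rw [mul_comm (f k i)]]
    rw [hubClass_mode_sum hρ hN hR hf γ hgt.le hi, hTexp i hi]
    have hRi1 : R (i + 1) = R i + N i * ρ i := by rw [hR (i + 1), sum_range_succ, ← hR i]
    have hRi : 0 < R i := by rw [hR i]; exact sum_pos (fun i _ => mul_pos (hN i) (hρ i)) ⟨j, mem_range.mpr hgt⟩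
    rw [hf i j, if_pos hgt, hf i i, if_neg (lt_irrefl i), if_pos rfl, hRi1]
    have hρi := hρ i; have hNi := hN i
    field_simp
    ring

/-- **Smith–Tierney form of the class resolvent, on the diagonal:** `u(j,j) = N_jρ_j𝒯(j) + γ_j`. [ours] -/
theorem hubClass_resolvent_diag (hρ : ∀ i, 0 < ρ i) (hmono : Monotone ρ) (hN : ∀ i, 0 < N i) (hR : ∀ k, R k = ∑ i ∈ range k, N i * ρ i)
    (hM : ∀ k, M k = ∑ i ∈ Ico k m, N i)
    (hPoff : ∀ i j, i ≠ j → P i j = c * N j * min 1 (ρ j / ρ i)) (hPdiag : ∀ i, P i i = 1 - ∑ j ∈ (range m).erase i, P i j)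
    (hf : ∀ k i, f k i = if i < k then ρ k else if i = k then -(R k / N k) else 0)
    (hβ : ∀ k, β k = 1 - c * (M k + R k / ρ k)) (hc : 0 ≤ c) (hcm : ∀ k, k < m → c * (M 0 - N k) ≤ 1) (hσ0 : 0 ≤ σ) (hσ1 : σ < 1)
    (hγ : ∀ k, γ k = (1 - σ) / (1 - σ * β k))
    (hu : ∀ i j, j < m → u i j = (1 - σ) * (if i = j then 1 else 0) + σ * ∑ l ∈ range m, u i l * P l j)
    (hTr : ∀ j, Tr j = (1 - γ j) / R m + ∑ k ∈ Ico (j + 1) m, (1 / R k - 1 / R (k + 1)) * (γ k - γ j))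
    {j : ℕ} (hj : j < m) : u j j = N j * ρ j * Tr j + γ j := by
  rw [hubClass_resolvent_eq hρ hmono hN hR hM hPoff hPdiag hf hβ hc hcm hσ0 hσ1 hγ hu hj hj, hubClass_mode_sum hρ hN hR hf γ le_rfl hj, hTr]
  have e : ∑ k ∈ Ico (j + 1) m, (1 / R k - 1 / R (k + 1)) * (γ k - γ j)
      = ∑ k ∈ Ico (j + 1) m, γ k * (1 / R k - 1 / R (k + 1)) - γ j * ∑ k ∈ Ico (j + 1) m, (1 / R k - 1 / R (k + 1)) := by
    rw [mul_sum, ← sum_sub_distrib]; exact sum_congr rfl fun k _ => by ring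
  rw [e, hubChain_telescope hj]
  have hRj1 : R (j + 1) = R j + N j * ρ j := by rw [hR (j + 1), sum_range_succ, ← hR j]
  have hR0 : 0 ≤ R j := by rw [hR j]; exact sum_nonneg fun i _ => mul_nonneg (hN i).le (hρ i).le
  have hρj := hρ j; have hNj := hN j
  have hRj1pos : 0 < R (j + 1) := by rw [hRj1]; nlinarith
  rw [hf j j, if_neg (lt_irrefl j), if_pos rfl, hRj1]
  by_cases hRj : R j = 0
  · rw [hRj]; simp; field_simp; ring
  · field_simp
    ring

end HubClassRes

end Summit.Ventures.LatticeQCDFlow.Scaling
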